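import Summits.HubbardSuperconductivity.HubbardSuperconductivity.Theorems.AnisotropyChordTransferFibre3Hole2L21a
import Summits.HubbardSuperconductivity.HubbardSuperconductivity.Theorems.AnisotropyChordTransferFibre3Hole2L21b

/-!
# Route `AnisotropyChord` / H0 rotor rung: ★ HOLE₂(.75) AT `L = 21` — `TwoHoleGap 21 (3/4·eps1 21)`

The one-body spectral input of the GM₃ assembly `gm3_of_hole2` (p1 g23) at side length `L = 21`: the Neumann gap of the rate-½ walk
on the `21 × 21` torus with ANY two vertices deleted is at least `¾ε₁(21)`.  Assembly of the kernel facts `checkRepsQ_21a…`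
(`…Hole2L21a…`, 2 part(s), 65 `D₄`-classes `0 ≤ y ≤ x ≤ 10`) via `checkRepsQ_append`, the `D₄`-coverage of the classes (`decide +kernel`),
and the soundness theorem `Hole2.twoHoleGap_of_checkRepsQ` (`…Fibre3Hole2Quarter`; p2's PROP BS, p1's reductions).
Prover seat `hubbard-h0-rotor-p3` g3; helper for stmt-HubbardSuperconductivity-19089 (`--supports`, helper class).
WHAT THIS IS NOT: nothing here proves superconductivity in the Hubbard model (rotor TARGET as worded stays FALSE, g15 verdict); this
discharges, at ONE side length, ONE hypothesis (HOLE₂(.75)) of ONE conditional reduction (rung 19089). Tree imports only; no sorry.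
-/

set_option linter.dupNamespace false
set_option autoImplicit false

namespace Summit.HubbardSuperconductivity.HubbardSuperconductivity.Theorems.AnisotropyChord.Transfer.Fibre3

namespace Hole2

/-- all 65 `D₄`-representatives of the nonzero separations of the `21 × 21` torus. [folklore] -/
def reps21 : List (ℕ × ℕ) := reps21a ++ reps21b

/-- every representative passes the kernel check. [folklore] -/
theorem checkRepsQ_21 : checkRepsQ 21 reps21 = true := checkRepsQ_append (checkRepsQ_21a) checkRepsQ_21b

/-- the representatives meet the `D₄`-orbit of every nonzero separation (finite check). [folklore] -/
theorem cover_21 : ∀ z : Tor 21, z ≠ 0 → ∃ s ∈ (reps21.map fun ab => sT 21 ab.1 ab.2).toFinset, s ∈ d4Orbit 21 z := by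
  decide +kernel

/-- ★★★ HOLE₂(.75) AT `L = 21`: `TwoHoleGap 21 (3/4 * eps1 21)`, the spectral hypothesis of `gm3_of_hole2` at `L = 21`. [folklore] -/
theorem twoHoleGap_twentyOne : TwoHoleGap 21 (3 / 4 * eps1 21) :=
  twoHoleGap_of_checkRepsQ 21 reps21 checkRepsQ_21 cover_21

end Hole2

end Summit.HubbardSuperconductivity.HubbardSuperconductivity.Theorems.AnisotropyChord.Transfer.Fibre3
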